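import Summits.HodgeConjecture.HodgeConjecture.Theorems.H413SpectrumInterfaces
import Summits.HodgeConjecture.HodgeConjecture.Theorems.P2StubU2lL2Realisation
import HarnessLib

/-!
# FLOOR-0 programme P2, stub U2ℓ CLOSED BY NAME: `SpectrumInterfaces.StubU2lL2Realisation`

Cell hodgecm-mathlib (D-0151), FLOOR 0; crux item H413 = stmt-HodgeConjecture-24833; sub-line `Cruxes/H413/Lines/F0_P2CohSpectrumL2.lean` (F0P2-plan (g0)),
registered stub `stub_U2l_l2Realisation : StubU2lL2Realisation` (:532) — its TYPE is the constant ★ `…Cruxes.H413.SpectrumInterfaces.StubU2lL2Realisation` of the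
shared module `Theorems/H413SpectrumInterfaces.lean` (token-identical body).  Seat F0P2-p01 (g0).

The content is ★ `Theorems/P2StubU2lL2Realisation.lean` (`exists_isAutomorphicMeasure_represents F V h4`: continuity of cotangent forms on `U(V)(𝔸_{F⁺})`,
descent to the compact quotient, `L²`-realisation); this file is the one-line fold at the face (`Represents` ∕ `quotMk` unfold by `rfl`; of the face's
binders only `4 ≤ 6 ≤ [F:ℚ]` is used).  So `stub_U2l_l2Realisation := P2StubU2lL2RealisationByName.stub_U2l_l2Realisation_holds` closes the cut's first
hole BY NAME.  THEOREMS ONLY.  HC_CM is proved only modulo the 7 printed citations until rung 0 closes; this file discharges none of them.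

## References
* [BorelJacquet1979] §4.2, §4.6.  [Borel1963] §5.  Tree: ★ `Theorems/H413SpectrumInterfaces` (the stub TYPE), ★ `Theorems/P2StubU2lL2Realisation` (the proof).
-/

set_option autoImplicit false

-- the mandated namespace has the single-problem summit's repeated segment (`HodgeConjecture.HodgeConjecture`)
set_option linter.dupNamespace false

noncomputable section

namespace Summit.HodgeConjecture.HodgeConjecture.Cruxes.H413.P2StubU2lL2RealisationByName

open Summit.HodgeConjecture.HodgeConjecture.Cruxes.H413.P2StubU2lL2Realisation (exists_isAutomorphicMeasure_represents)



/-- **STUB U2ℓ OF THE CUT, BY NAME**: for every face there are an automorphic measure `μ` on `U(V)(F⁺)\U(V)(𝔸_{F⁺})` and a linear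
`ℓ : X →ₗ[ℂ] (Fin 2 → L²(μ))` which `Represents` the `(1,0) ⊕ (0,1)` cotangent forms of the factor of record (continuous descended representatives
`[h] ↦ f(h⁻¹) k`). [cite: BorelJacquet1979, §4.2, §4.6] [cite: Borel1963, §5] -/
theorem stub_U2l_l2Realisation_holds : SpectrumInterfaces.StubU2lL2Realisation :=
  fun _hDel F _ h6 _ι₁ V _a₀ _Φ _hΦ _i => exists_isAutomorphicMeasure_represents F V (le_trans (by norm_num) h6)

end Summit.HodgeConjecture.HodgeConjecture.Cruxes.H413.P2StubU2lL2RealisationByName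

end
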